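import Mathlib
import Summits.ValiantsHypothesis.ValiantsHypothesis.Theorems.MonotoneRestorationOrbitRestorationQPDepthThreeRungDefs
import Summits.ValiantsHypothesis.ValiantsHypothesis.Theorems.MonotoneRestorationOrbitRestorationQPValueDerivation
import HarnessLib

/-!
# Route MonotoneRestoration — crux `OrbitRestorationQP` (stmt-ValiantsHypothesis-18293): vocabulary for the WILD RESIDUE of
# the rung `A_∞` of line `depth-three-rung` (route-posited objects, D-0016 `<RouteSlug>Defs.lean`)

The open stub `stub_sigmaPiSigmaValue` (A_∞) of `Cruxes/OrbitRestorationQP/Lines/depth_three_rung.lean` is reduced, in the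
kernel, to a statement about the levels at which a matrix-symmetric polynomial of polynomial depth-three complexity has NO
cheap depth-three representation whose terms can be GROUPED into pieces settled by the landed strata
(`Theorems/MonotoneRestorationOrbitRestorationQP{TameStratum,Residue,SymmetricTerms,GroupedTerms,FewTerms}.lean`:
`GroupedTerms.sigmaPiSigmaValue_of_wildResidue₄`, `FewTerms.sigmaPiSigmaValue_of_rankBound_of_wildResidue₅`).  Those theorems
spell the residue out inline (≈ 2000 characters).  So that a planner can re-register the rung's remaining content as ONE short
stub, this file NAMES the two notions, verbatim as they occur there.  Nothing here asserts anything; no instance, no notation.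

* `GroupableUpTo K n c p` — `p` has a depth-three representation `p = Σ_{i<k} C(a i) · Π (L i)` (every `L i` a multiset of
  `≤ n^c + c` polynomials of total degree `≤ 1`) together with a partition `g : Fin k → Fin m` of its terms into groups, each of
  which is (T) diagonally invariant with all factor multisets TAME (`≤ 2^((log₂ n + c)^c)` diagonal translates), or (S) made of
  matrix-symmetric terms, or (B) matrix-symmetric with total BOX VOLUME `≤ n^c + c`, or (K) made of at most `K` terms with
  matrix-symmetric sum;
* `WildResidue K` (for a group-size budget `K : ℕ → ℕ`) — for every `c` there is `c'` such that every matrix-symmetric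
  `p ∈ PDClass (fun _ => 1) n c` that is NOT `GroupableUpTo (K c) n c` is `QPOrbitRestorable c' n p`.

`WildResidue (fun _ => 0)` implies A_∞ unconditionally and `WildResidue id` implies A_∞ granting `depthThree_rankBound`
(proved in `Theorems/MonotoneRestorationOrbitRestorationQPWildResidue.lean`).  Calibration: open-problem grade (no example and
no mechanism known); nothing here bears on VP ≠ VNP.
[cite: DawarWilsenach2025, §3.3 (ORB); SaxenaSeshadhri2013, Theorem 5]
-/

noncomputable section

-- `Summit.ValiantsHypothesis.ValiantsHypothesis.…` is the tree's single-conjunct layout (Sub = Summit).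
set_option linter.dupNamespace false

namespace Summit.ValiantsHypothesis.ValiantsHypothesis.Theorems.OrbitRestorationQPDepthThreeRung

open Finset

/-- **Groupable depth-three representation** at level `n` with budget `c` and group-size budget `K` for kind (K):
`p = Σ_{i<k} C(a i) · Π (L i)` with affine factors, `|L i| ≤ n^c + c`, and a partition `g : Fin k → Fin m` of the terms into
groups each of kind (T) tame & diagonally invariant, (S) matrix-symmetric terms, (B) matrix-symmetric & total box volume
`≤ n^c + c`, or (K) at most `K` terms & matrix-symmetric sum (verbatim the positive datum negated in
`FewTerms.sigmaPiSigmaValue_of_rankBound_of_wildResidue₅`, with `K` in place of `c` in kind (K)). [folklore] -/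
def GroupableUpTo (K n c : ℕ) (p : MvPolynomial (Fin n × Fin n) ℂ) : Prop :=
  ∃ (k : ℕ) (a : Fin k → ℂ) (L : Fin k → Multiset (MvPolynomial (Fin n × Fin n) ℂ)) (m : ℕ) (g : Fin k → Fin m),
    (∀ i, ∀ ℓ ∈ L i, ℓ.totalDegree ≤ 1) ∧ (∀ i, Multiset.card (L i) ≤ n ^ c + c) ∧
    p = ∑ i, MvPolynomial.C (a i) * (L i).prod ∧
    ∀ j : Fin m,
      ((∀ σ : Equiv.Perm (Fin n),
          ren σ (∑ i ∈ univ.filter (fun i => g i = j), MvPolynomial.C (a i) * (L i).prod) =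
            ∑ i ∈ univ.filter (fun i => g i = j), MvPolynomial.C (a i) * (L i).prod) ∧
        ∀ i, g i = j →
          (Set.range fun σ : Equiv.Perm (Fin n) => (L i).map (ren σ)).ncard ≤ 2 ^ ((Nat.log 2 n + c) ^ c)) ∨
      (∀ i, g i = j → ∀ σ τ : Equiv.Perm (Fin n), MvPolynomial.rename (fun q : Fin n × Fin n => (σ q.1, τ q.2))
          (MvPolynomial.C (a i) * (L i).prod) = MvPolynomial.C (a i) * (L i).prod) ∨
      ((∀ σ τ : Equiv.Perm (Fin n), MvPolynomial.rename (fun q : Fin n × Fin n => (σ q.1, τ q.2))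
          (∑ i ∈ univ.filter (fun i => g i = j), MvPolynomial.C (a i) * (L i).prod) =
          ∑ i ∈ univ.filter (fun i => g i = j), MvPolynomial.C (a i) * (L i).prod) ∧
        (∑ i ∈ univ.filter (fun i => g i = j), ∏ ℓ ∈ (L i).toFinset, ((L i).count ℓ + 1)) ≤ n ^ c + c) ∨
      ((∀ σ τ : Equiv.Perm (Fin n), MvPolynomial.rename (fun q : Fin n × Fin n => (σ q.1, τ q.2))
          (∑ i ∈ univ.filter (fun i => g i = j), MvPolynomial.C (a i) * (L i).prod) =
          ∑ i ∈ univ.filter (fun i => g i = j), MvPolynomial.C (a i) * (L i).prod) ∧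
        (univ.filter (fun i => g i = j)).card ≤ K)

/-- **The WILD RESIDUE of the rung `A_∞`** with group-size budget `K : ℕ → ℕ` for kind (K): for every `c` there is `c'` such
that every matrix-symmetric `p` at level `n` in `PDClass (fun _ => 1) n c` which is NOT `GroupableUpTo (K c) n c` is
`QPOrbitRestorable c' n p`.  `WildResidue (fun _ => 0)` ⇒ A_∞; `depthThree_rankBound → WildResidue id → A_∞`
(`Theorems/MonotoneRestorationOrbitRestorationQPWildResidue.lean`). [conjecture-grade residue of a conjecture-grade rung] -/
def WildResidue (K : ℕ → ℕ) : Prop :=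
  ∀ c : ℕ, ∃ c' : ℕ, ∀ (n : ℕ) (p : MvPolynomial (Fin n × Fin n) ℂ),
    (∀ σ τ : Equiv.Perm (Fin n), MvPolynomial.rename (fun q : Fin n × Fin n => (σ q.1, τ q.2)) p = p) →
    PDClass (fun _ => 1) n c p → ¬ GroupableUpTo (K c) n c p → QPOrbitRestorable c' n p

end Summit.ValiantsHypothesis.ValiantsHypothesis.Theorems.OrbitRestorationQPDepthThreeRung

end
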